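import Summits.Ventures.HodgeRepro2.T5SU11JacobiPhaseTailGroup

/-!
# The phase is stochastically decreasing in the weight: `P_{k,λ}(log|a| > x)` is antitone in `k`

`T5SU11JacobiCompleteMonotonePhase` / `T5SU11JacobiPhaseMGF` say the phase decreases in the weight in the LAPLACE
order (the decay ratio `m̂_{k+h}/m̂_k` is monotone in `k`). Here the statement IN DISTRIBUTION: for `k₁ ≤ k₂` on the
ray, every `λ` and every `x ≥ 0`,

  **`P_{k₂,λ}(log|a| > x) ≤ P_{k₁,λ}(log|a| > x)`**   (`phase_tail_prob_antitone`),

i.e. the law of the phase under `m_{k₂} φ_λ dν/m̂_{k₂}(λ)` is stochastically dominated by that under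
`m_{k₁} φ_λ dν/m̂_{k₁}(λ)`. The proof is **Chebyshev's integral inequality** (`integral_mul_mul_le_of_antitone_monotone`:
for a weight `w ≥ 0` on `(0, ∞)`, an antitone `f` and a monotone `g`, `∫ f g w · ∫ w ≤ ∫ f w · ∫ g w` — the double
integral `∫∫ (f(s) − f(t))(g(s) − g(t)) w(s) w(t) ≤ 0` expanded by Fubini, `MeasureTheory.integral_prod_mul`) applied
to `w = e^{−(k₁−2)s} Φ_λ`, `f = e^{−(k₂−k₁)s}` (antitone) and `g = 1_{(x,∞)}` (monotone): in the Laplace tails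
`N_k(x) = ∫_x^∞ e^{−(k−2)s} Φ_λ(s) ds` this reads `N_{k₂}(x) N_{k₁}(0) ≤ N_{k₂}(0) N_{k₁}(x)` (`tail_mul_le_tail_mul`),
and the tail probabilities are `N_k(x)/N_k(0)` (`T5SU11JacobiPhaseTailGroup`). In particular the mean phase is antitone
in the weight (`T5SU11JacobiPhaseOrbitCovariance.mean_phase_antitone`) as the expectation of an increasing function
must be. Nothing is claimed about (N).

Blind lane: Mathlib + the HodgeRepro2 prefix only; no sorry; axioms ⊆ {propext, Classical.choice,
Quot.sound}.
-/

namespace Summit.Ventures.HodgeRepro2.T5SU11JacobiPhaseTailMonotone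

open MeasureTheory MeasureTheory.Measure Metric Set Filter Topology
open T5SU11Unimodular T5SU11Fibration T5SU11Cartan T5SU11OneParameter T5SU11CartanProjection T5HaarCircle
  T5BergmanCoefficient T5SU11FibrationHaar T5SU11SphericalFunction T5SU11SphericalSymmetry
  T5SU11SphericalBounds T5SU11SphericalContinuous T5SU11JacobiIwasawa T5SU11JacobiTransform
  T5SU11JacobiWeight T5SU11KFiniteMajorantPow T5SU11JacobiLaplacePhase T5SU11JacobiPhaseTailGroup
open scoped Real

/-! ### Chebyshev's integral inequality on `(0, ∞)` -/

/-- **Chebyshev's integral inequality**: for a weight `w ≥ 0`, an antitone `f` and a monotone `g` on `ℝ` with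
`w`, `f w`, `g w`, `f g w` integrable on `(0, ∞)`,
`(∫_0^∞ f g w) (∫_0^∞ w) ≤ (∫_0^∞ f w) (∫_0^∞ g w)` — a decreasing and an increasing function are negatively
correlated under any finite measure (`∫∫ (f(s) − f(t))(g(s) − g(t)) w(s) w(t) ≤ 0`, expanded by Fubini). -/
theorem integral_mul_mul_le_of_antitone_monotone {w f g : ℝ → ℝ} (hw : ∀ s, 0 ≤ w s) (hf : Antitone f)
    (hg : Monotone g) (hwi : IntegrableOn w (Ioi 0)) (hfw : IntegrableOn (fun s => f s * w s) (Ioi 0))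
    (hgw : IntegrableOn (fun s => g s * w s) (Ioi 0))
    (hfgw : IntegrableOn (fun s => f s * g s * w s) (Ioi 0)) :
    (∫ s in Ioi (0 : ℝ), f s * g s * w s) * (∫ s in Ioi (0 : ℝ), w s)
      ≤ (∫ s in Ioi (0 : ℝ), f s * w s) * (∫ s in Ioi (0 : ℝ), g s * w s) := by
  set μ : Measure ℝ := volume.restrict (Ioi 0) with hμ
  -- the four product terms
  set A : ℝ × ℝ → ℝ := fun z => (f z.1 * g z.1 * w z.1) * w z.2 with hA
  set B : ℝ × ℝ → ℝ := fun z => w z.1 * (f z.2 * g z.2 * w z.2) with hB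
  set C : ℝ × ℝ → ℝ := fun z => (f z.1 * w z.1) * (g z.2 * w z.2) with hC
  set D : ℝ × ℝ → ℝ := fun z => (g z.1 * w z.1) * (f z.2 * w z.2) with hD
  have h1 : Integrable A (μ.prod μ) := hfgw.mul_prod hwi
  have h2 : Integrable B (μ.prod μ) := hwi.mul_prod hfgw
  have h3 : Integrable C (μ.prod μ) := hfw.mul_prod hgw
  have h4 : Integrable D (μ.prod μ) := hgw.mul_prod hfw
  -- the double integral of `(f(s) − f(t))(g(s) − g(t)) w(s) w(t)` is `≤ 0`
  have hpt : ∀ z : ℝ × ℝ, (f z.1 - f z.2) * (g z.1 - g z.2) * (w z.1 * w z.2) ≤ 0 := fun z => by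
    have hw2 : 0 ≤ w z.1 * w z.2 := mul_nonneg (hw _) (hw _)
    rcases le_total z.1 z.2 with h | h
    · have hf' : f z.2 ≤ f z.1 := hf h
      have hg' : g z.1 ≤ g z.2 := hg h
      exact mul_nonpos_of_nonpos_of_nonneg (mul_nonpos_of_nonneg_of_nonpos (by linarith) (by linarith)) hw2
    · have hf' : f z.1 ≤ f z.2 := hf h
      have hg' : g z.2 ≤ g z.1 := hg h
      exact mul_nonpos_of_nonpos_of_nonneg (mul_nonpos_of_nonpos_of_nonneg (by linarith) (by linarith)) hw2
  have hI : ∫ z : ℝ × ℝ, (A + B) z - (C + D) z ∂(μ.prod μ) ≤ 0 := by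
    refine integral_nonpos fun z => ?_
    have e : (A + B) z - (C + D) z = (f z.1 - f z.2) * (g z.1 - g z.2) * (w z.1 * w z.2) := by
      simp only [Pi.add_apply, hA, hB, hC, hD]
      ring
    rw [e]
    exact hpt z
  -- expand by Fubini
  have v1 : ∫ z, A z ∂(μ.prod μ) = (∫ s, f s * g s * w s ∂μ) * ∫ s, w s ∂μ :=
    integral_prod_mul (fun s => f s * g s * w s) w
  have v2 : ∫ z, B z ∂(μ.prod μ) = (∫ s, w s ∂μ) * ∫ s, f s * g s * w s ∂μ :=
    integral_prod_mul w (fun s => f s * g s * w s)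
  have v3 : ∫ z, C z ∂(μ.prod μ) = (∫ s, f s * w s ∂μ) * ∫ s, g s * w s ∂μ :=
    integral_prod_mul (fun s => f s * w s) (fun s => g s * w s)
  have v4 : ∫ z, D z ∂(μ.prod μ) = (∫ s, g s * w s ∂μ) * ∫ s, f s * w s ∂μ :=
    integral_prod_mul (fun s => g s * w s) (fun s => f s * w s)
  rw [integral_sub (h1.add h2) (h3.add h4)] at hI
  simp only [Pi.add_apply] at hI
  rw [integral_add h1 h2, integral_add h3 h4, v1, v2, v3, v4] at hI
  linarith

section measure

variable [MeasurableSpace Circle] [BorelSpace Circle]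

/-! ### The Laplace tails: `N_{k₂}(x) N_{k₁}(0) ≤ N_{k₂}(0) N_{k₁}(x)` -/

omit [BorelSpace Circle] in
/-- The tail `∫_x^∞ e^{−(k−2)s} Φ_λ(s) ds` as an integral over `(0, ∞)` of the indicator of `(x, ∞)`, `x ≥ 0`. -/
theorem tail_eq_integral_indicator (k lam : ℝ) {x : ℝ} (hx : 0 ≤ x) :
    ∫ s in Ioi x, Real.exp (-((k - 2) * s)) * sphPhase lam s
      = ∫ s in Ioi (0 : ℝ), (Ioi x).indicator (fun _ => (1 : ℝ)) s
          * (Real.exp (-((k - 2) * s)) * sphPhase lam s) := by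
  have e : ∀ s : ℝ, (Ioi x).indicator (fun _ => (1 : ℝ)) s * (Real.exp (-((k - 2) * s)) * sphPhase lam s)
      = (Ioi x).indicator (fun s => Real.exp (-((k - 2) * s)) * sphPhase lam s) s := fun s => by
    by_cases hs : s ∈ Ioi x
    · rw [indicator_of_mem hs, indicator_of_mem hs, one_mul]
    · rw [indicator_of_notMem hs, indicator_of_notMem hs, zero_mul]
  simp_rw [e]
  rw [integral_indicator measurableSet_Ioi, Measure.restrict_restrict measurableSet_Ioi,
    Ioi_inter_Ioi, show max x 0 = x from max_eq_left hx]

/-- **`N_{k₂}(x) N_{k₁}(0) ≤ N_{k₂}(0) N_{k₁}(x)`** for `k₁ ≤ k₂` on the ray and `x ≥ 0` (Chebyshev with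
`w = e^{−(k₁−2)s} Φ_λ`, `f = e^{−(k₂−k₁)s}`, `g = 1_{(x,∞)}`). -/
theorem tail_mul_le_tail_mul {k₁ k₂ lam : ℝ} (hk : 1 < k₁) (h1 : lam < k₁) (h2 : 2 < k₁ + lam)
    (hle : k₁ ≤ k₂) {x : ℝ} (hx : 0 ≤ x) :
    (∫ s in Ioi x, Real.exp (-((k₂ - 2) * s)) * sphPhase lam s)
        * (∫ s in Ioi (0 : ℝ), Real.exp (-((k₁ - 2) * s)) * sphPhase lam s)
      ≤ (∫ s in Ioi (0 : ℝ), Real.exp (-((k₂ - 2) * s)) * sphPhase lam s)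
        * (∫ s in Ioi x, Real.exp (-((k₁ - 2) * s)) * sphPhase lam s) := by
  set w : ℝ → ℝ := fun s => Real.exp (-((k₁ - 2) * s)) * sphPhase lam s with hw
  set f : ℝ → ℝ := fun s => Real.exp (-((k₂ - k₁) * s)) with hf
  set g : ℝ → ℝ := fun s => (Ioi x).indicator (fun _ => (1 : ℝ)) s with hg
  have hw0 : ∀ s, 0 ≤ w s := fun s => mul_nonneg (Real.exp_pos _).le (sphPhase_pos lam s).le
  have hfa : Antitone f := fun s t hst => by
    simp only [hf]
    exact Real.exp_le_exp.mpr (by nlinarith)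
  have hgm : Monotone g := fun s t hst => by
    simp only [hg]
    by_cases hs : s ∈ Ioi x
    · have ht : t ∈ Ioi x := lt_of_lt_of_le (mem_Ioi.mp hs) hst
      rw [indicator_of_mem hs, indicator_of_mem ht]
    · rw [indicator_of_notMem hs]
      exact indicator_nonneg (fun _ _ => zero_le_one) t
  -- the four functions
  have hfw_eq : ∀ s, f s * w s = Real.exp (-((k₂ - 2) * s)) * sphPhase lam s := fun s => by
    simp only [hf, hw]
    rw [← mul_assoc, ← Real.exp_add]
    congr 2
    ring
  have hwi : IntegrableOn w (Ioi 0) := integrableOn_exp_mul_sphPhase hk h1 h2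
  have hfw : IntegrableOn (fun s => f s * w s) (Ioi 0) := by
    simp_rw [hfw_eq]
    exact integrableOn_exp_mul_sphPhase (by linarith) (by linarith) (by linarith)
  have hgw : IntegrableOn (fun s => g s * w s) (Ioi 0) := by
    have : (fun s => g s * w s) = (Ioi x).indicator w := by
      funext s
      simp only [hg]
      by_cases hs : s ∈ Ioi x
      · rw [indicator_of_mem hs, indicator_of_mem hs, one_mul]
      · rw [indicator_of_notMem hs, indicator_of_notMem hs, zero_mul]
    rw [this]
    exact hwi.indicator measurableSet_Ioi
  have hfgw : IntegrableOn (fun s => f s * g s * w s) (Ioi 0) := by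
    have : (fun s => f s * g s * w s) = (Ioi x).indicator (fun s => f s * w s) := by
      funext s
      simp only [hg]
      by_cases hs : s ∈ Ioi x
      · rw [indicator_of_mem hs, indicator_of_mem hs, mul_one]
      · rw [indicator_of_notMem hs, indicator_of_notMem hs, mul_zero, zero_mul]
    rw [this]
    exact hfw.indicator measurableSet_Ioi
  have key := integral_mul_mul_le_of_antitone_monotone hw0 hfa hgm hwi hfw hgw hfgw
  -- identify the four integrals
  have e1 : ∫ s in Ioi (0 : ℝ), f s * g s * w s
      = ∫ s in Ioi x, Real.exp (-((k₂ - 2) * s)) * sphPhase lam s := by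
    rw [tail_eq_integral_indicator k₂ lam hx]
    refine setIntegral_congr_fun measurableSet_Ioi fun s _ => ?_
    rw [← hfw_eq s]
    simp only [hg]
    ring
  have e2 : ∫ s in Ioi (0 : ℝ), f s * w s = ∫ s in Ioi (0 : ℝ), Real.exp (-((k₂ - 2) * s)) * sphPhase lam s :=
    setIntegral_congr_fun measurableSet_Ioi fun s _ => hfw_eq s
  have e3 : ∫ s in Ioi (0 : ℝ), g s * w s = ∫ s in Ioi x, Real.exp (-((k₁ - 2) * s)) * sphPhase lam s := by
    rw [tail_eq_integral_indicator k₁ lam hx]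
  rw [e1, e2, e3] at key
  exact key

/-! ### On the group -/

/-- **THE PHASE IS STOCHASTICALLY DECREASING IN THE WEIGHT**: for `k₁ ≤ k₂` on the ray, every `λ` and every `x ≥ 0`,
`P_{k₂,λ}(log|a| > x) ≤ P_{k₁,λ}(log|a| > x)` for the probability measures `m_k φ_λ dν/m̂_k(λ)`. -/
theorem phase_tail_prob_antitone {k₁ k₂ lam : ℝ} (hk : 1 < k₁) (h1 : lam < k₁) (h2 : 2 < k₁ + lam)
    (hle : k₁ ≤ k₂) {x : ℝ} (hx : 0 ≤ x) :
    (∫ g in {g : SU11 | x < Real.log ‖mat g 0 0‖}, (1 - ‖orbit g‖ ^ 2) ^ (k₂ / 2) * sph lam g ∂(nu haarCircle))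
        / (∫ g, (1 - ‖orbit g‖ ^ 2) ^ (k₂ / 2) * sph lam g ∂(nu haarCircle))
      ≤ (∫ g in {g : SU11 | x < Real.log ‖mat g 0 0‖}, (1 - ‖orbit g‖ ^ 2) ^ (k₁ / 2) * sph lam g ∂(nu haarCircle))
        / (∫ g, (1 - ‖orbit g‖ ^ 2) ^ (k₁ / 2) * sph lam g ∂(nu haarCircle)) := by
  rw [integral_phase_tail_eq hk h1 h2 hx, integral_phase_tail_eq (by linarith) (by linarith) (by linarith) hx,
    jacobi_eq_laplace_phase hk h1 h2, jacobi_eq_laplace_phase (by linarith) (by linarith) (by linarith),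
    mul_div_mul_left _ _ (by positivity : (2 * π : ℝ) ≠ 0),
    mul_div_mul_left _ _ (by positivity : (2 * π : ℝ) ≠ 0)]
  have hN1 : 0 < ∫ s in Ioi (0 : ℝ), Real.exp (-((k₁ - 2) * s)) * sphPhase lam s := by
    have := jacobi_pos hk h1 h2
    rw [jacobi_eq_laplace_phase hk h1 h2] at this
    exact pos_of_mul_pos_right this (by positivity)
  have hN2 : 0 < ∫ s in Ioi (0 : ℝ), Real.exp (-((k₂ - 2) * s)) * sphPhase lam s := by
    have := jacobi_pos (k := k₂) (lam := lam) (by linarith) (by linarith) (by linarith)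
    rw [jacobi_eq_laplace_phase (by linarith) (by linarith) (by linarith)] at this
    exact pos_of_mul_pos_right this (by positivity)
  rw [div_le_div_iff₀ hN2 hN1]
  exact (tail_mul_le_tail_mul hk h1 h2 hle hx).trans_eq (by ring)

end measure

end Summit.Ventures.HodgeRepro2.T5SU11JacobiPhaseTailMonotone
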